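import Literature.NumberTheory.GaloisRepresentations.ContinuousCohomologyCoboundaryLift
import HarnessLib

/-!
# Cup products one of whose factors bounds in an ambient module: `a ∪ b` as a connecting class
# (Kato's "formal argument on cohomology", LNM 1553, Ch. II, proof of Lemma 1.4.3)

Topic `Literature/NumberTheory/GaloisRepresentations`; THEOREMS ONLY (no definition, no named fact, no
instance, no `sorry`). Sequel to `ContinuousCohomologyCoboundaryLift` (the predicate `IsCoboundaryLift`:
a continuous `2`-cocycle of `M` presented as the coboundary of a cochain of an ambient algebraic
`Γ`-module `B ⊇ ι(M)`) and to the tree's continuous cup product `H¹ × H¹ → H²`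
(`ContinuousCupProduct`, `ContinuousH2`: `(a ∪ b)(σ, τ) = ⟨a σ, σ b τ⟩`, `ContPairing.cupCocycle`).

## The statement (pure cochain algebra)

Let `⟨ , ⟩ : X × Y → M` be a continuous equivariant pairing (`ContPairing X Y M`), and suppose the
crossed homomorphism `a : Γ → X` BECOMES A COBOUNDARY in an ambient `Γ`-module `X̃ ⊇ X`:
`a(σ) = σ x̃ - x̃` (`x̃ ∈ X̃`; no topology on `X̃`). If the pairing extends to an additive equivariant
`⟨ , ⟩~ : X̃ × Y → B` with values in an ambient module `B ⊇ ι(M)` (`⟨x, y⟩~ = ι ⟨x, y⟩` on `X × Y`), then for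
every crossed homomorphism `b : Γ → Y` the `1`-cochain

  `f(τ) := ⟨x̃, b(τ)⟩~ ∈ B`     satisfies     `σ f(τ) - f(στ) + f(σ) = ι ((a ∪ b)(σ, τ))`,

i.e. `f` presents the cup-product cocycle `a ∪ b` as a coboundary in `B`
(`ContPairing.isCoboundaryLift_cupCocycle_left`). Symmetrically, if `b(τ) = τ ỹ - ỹ` in `Ỹ ⊇ Y` and the
pairing extends to `X × Ỹ → B`, then `g(σ) := -⟨a(σ), σ ỹ⟩~` presents `a ∪ b`
(`ContPairing.isCoboundaryLift_cupCocycle_right`). Consequently `a ∪ b ∈ H²_cont(Γ, M)` is the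
CONNECTING CLASS of the explicit cochain `f` (resp. `g`) for `0 → M → B → B/M → 0`, and the calculus of
`ContinuousCohomologyCoboundaryLift` applies to it: `[a ∪ b] = [c']` for any other presentation
`f' ≡ f mod ι ∘ C(Γ, M) + Z¹(Γ, B)` (`cupClass_eq_twoCocycleClass_of_isCoboundaryLift_left/right`), and
`[a ∪ b] = 0` iff `f ∈ ι ∘ C(Γ, M) + Z¹(Γ, B)` (`cupClass_eq_zero_iff_left`).

This is exactly the "formal argument on cohomology" in Kato's proof of LNM 1553, Ch. II, Lemma 1.4.3
(`exp(a) ∪ b = δ(⟨a, exp*(b)⟩ · log χ_cyclo)`): there `X = V`, `Y = V*(1)`, `M = ℚ_p(1)`, `X̃ = B ⊗ V` for a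
period ring `B` in which the cocycle `exp(a)` (or a Kummer cocycle) becomes a coboundary, and
`B ⊇ ℚ_p(1) = ℚ_p · t`; the recognition of the resulting class in `H¹(K, B/ℚ_p(1))` is the (separate)
`p`-adic Hodge-theoretic input. Nothing about `B_dR` is used or proved here.

## References
* K. Kato, *Lectures on the approach to Iwasawa theory for Hasse–Weil L-functions via B_dR, I*, LNM 1553
  (1993), Ch. II, proof of Lemma 1.4.3. [Kato1993LNM1553]
* J. Neukirch, A. Schmidt, K. Wingberg, *Cohomology of Number Fields*, 2nd ed. (2008), I §3 (1.3.2),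
  I §4 (1.4.3)–(1.4.6) (cup products and connecting homomorphisms on cochains). [NeukirchSchmidtWingberg2008]
-/

noncomputable section

open CategoryTheory Function

universe u

namespace Literature.NumberTheory.GaloisRepresentations

open _root_.TopRep _root_.ContRepresentation _root_.ContinuousCohomology

namespace ContPairing

variable {R : Type*} [CommRing R] [TopologicalSpace R]
variable {Γ : Type u} [Group Γ] [TopologicalSpace Γ] [IsTopologicalGroup Γ]
variable {X Y : TopRep.{u} R Γ}
variable {M : Type u} [AddCommGroup M] [Module R M] [TopologicalSpace M] [IsTopologicalAddGroup M]
  [ContinuousSMul R M]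
variable {ρ : ContinuousRep Γ R M}
variable (P : ContPairing X Y ρ.toTopRep)
variable {S : Type*} [CommSemiring S] {B : Type*} [AddCommGroup B] [Module S B]
variable {π : Representation S Γ B} {ι : M →+ B}

/-! ### Left factor a coboundary in an ambient module -/

section Left

variable {SX : Type*} [CommSemiring SX] {Xt : Type*} [AddCommGroup Xt] [Module SX Xt]
variable {πX : Representation SX Γ Xt} {ιX : X →+ Xt} {Pt : Xt →+ Y →+ B}

/-- ★ **Kato's formal argument, left factor.** If `a(σ) = σ x̃ - x̃` in an ambient module `X̃ ⊇ X` and the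
pairing extends equivariantly to `⟨ , ⟩~ : X̃ × Y → B ⊇ ι(M)`, then `f(τ) := ⟨x̃, b τ⟩~` presents the
cup-product cocycle: `σ f(τ) - f(στ) + f(σ) = ι ⟨a σ, σ b τ⟩ = ι ((a ∪ b)(σ, τ))`.
[cite: Kato1993LNM1553, Ch. II, proof of Lemma 1.4.3] [cite: NeukirchSchmidtWingberg2008, I §3 (1.3.2), I §4] -/
theorem isCoboundaryLift_cupCocycle_left
    (hequiv : ∀ (σ : Γ) (x : Xt) (y : Y), π σ (Pt x y) = Pt (πX σ x) (Y.ρ σ y))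
    (hcompat : ∀ (x : X) (y : Y), Pt (ιX x) y = ι (P.toLin x y))
    (a : contOneCocycles X) (x₀ : Xt) (ha : ∀ σ, ιX (a.1 σ) = πX σ x₀ - x₀) (b : contOneCocycles Y) :
    IsCoboundaryLift π ι (fun τ => Pt x₀ (b.1 τ)) (P.cupCocycle a b) := fun σ τ => by
  dsimp only
  rw [cupCocycle_apply_eq_smul, ← hcompat, ha, hequiv, b.2 σ τ, map_add, map_sub,
    AddMonoidHom.sub_apply]
  abel

variable [LocallyCompactSpace Γ]

/-- Hence **`[a ∪ b]` is the class of ANY cocycle presented by `f(τ) = ⟨x̃, b τ⟩~`** (`ι` injective).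
[cite: Kato1993LNM1553, Ch. II, proof of Lemma 1.4.3] -/
theorem cupClass_eq_twoCocycleClass_of_isCoboundaryLift_left (hinj : Injective ι)
    (hequiv : ∀ (σ : Γ) (x : Xt) (y : Y), π σ (Pt x y) = Pt (πX σ x) (Y.ρ σ y))
    (hcompat : ∀ (x : X) (y : Y), Pt (ιX x) y = ι (P.toLin x y))
    (a : contOneCocycles X) (x₀ : Xt) (ha : ∀ σ, ιX (a.1 σ) = πX σ x₀ - x₀) (b : contOneCocycles Y)
    {c : contTwoCocycles ρ.toTopRep} (hc : IsCoboundaryLift π ι (fun τ => Pt x₀ (b.1 τ)) c) :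
    P.cupClass a b = twoCocycleClass ρ.toTopRep c := by
  rw [cupClass_eq_twoCocycleClass,
    (P.isCoboundaryLift_cupCocycle_left hequiv hcompat a x₀ ha b).unique hinj hc]

/-- **The cup product on classes as a connecting class**: `[a] ∪ [b] = [c]` for every presentation `c`
of a cochain `f' = (τ ↦ ⟨x̃, b τ⟩~) + ι ∘ h + z`, `h : Γ → M` continuous, `z` a `1`-cocycle of `B`
(independence of the lift). [cite: Kato1993LNM1553, Ch. II, proof of Lemma 1.4.3]
[cite: NeukirchSchmidtWingberg2008, I §3 (1.3.2)] -/
theorem cupProduct_eq_twoCocycleClass_of_isCoboundaryLift_left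
    (hι : ∀ (σ : Γ) (x : M), ι (ρ σ x) = π σ (ι x)) (hinj : Injective ι)
    (hequiv : ∀ (σ : Γ) (x : Xt) (y : Y), π σ (Pt x y) = Pt (πX σ x) (Y.ρ σ y))
    (hcompat : ∀ (x : X) (y : Y), Pt (ιX x) y = ι (P.toLin x y))
    (a : contOneCocycles X) (x₀ : Xt) (ha : ∀ σ, ιX (a.1 σ) = πX σ x₀ - x₀) (b : contOneCocycles Y)
    {f' : Γ → B} {c' : contTwoCocycles ρ.toTopRep} (hc' : IsCoboundaryLift π ι f' c') (h : C(Γ, M))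
    (z : Γ → B) (hz : ∀ σ τ, z (σ * τ) = z σ + π σ (z τ))
    (e : ∀ σ, f' σ = Pt x₀ (b.1 σ) + ι (h σ) + z σ) :
    P.cupProduct (oneCocycleClass X a) (oneCocycleClass Y b) = twoCocycleClass ρ.toTopRep c' := by
  rw [cupProduct_oneCocycleClass_eq_twoCocycleClass]
  exact ((P.isCoboundaryLift_cupCocycle_left hequiv hcompat a x₀ ha b).twoCocycleClass_eq hι hinj hc'
    h z hz e).symm

/-- **Vanishing criterion**: `[a ∪ b] = 0` iff `τ ↦ ⟨x̃, b τ⟩~` is `ι ∘ h` plus a `1`-cocycle of `B` for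
some continuous `h : Γ → M`. [cite: Kato1993LNM1553, Ch. II, proof of Lemma 1.4.3]
[cite: NeukirchSchmidtWingberg2008, I §3 (1.3.2)] -/
theorem cupClass_eq_zero_iff_left (hι : ∀ (σ : Γ) (x : M), ι (ρ σ x) = π σ (ι x))
    (hinj : Injective ι)
    (hequiv : ∀ (σ : Γ) (x : Xt) (y : Y), π σ (Pt x y) = Pt (πX σ x) (Y.ρ σ y))
    (hcompat : ∀ (x : X) (y : Y), Pt (ιX x) y = ι (P.toLin x y))
    (a : contOneCocycles X) (x₀ : Xt) (ha : ∀ σ, ιX (a.1 σ) = πX σ x₀ - x₀) (b : contOneCocycles Y) :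
    P.cupClass a b = 0 ↔ ∃ h : C(Γ, M), ∀ σ τ,
      Pt x₀ (b.1 (σ * τ)) - ι (h (σ * τ)) =
        (Pt x₀ (b.1 σ) - ι (h σ)) + π σ (Pt x₀ (b.1 τ) - ι (h τ)) := by
  rw [cupClass_eq_twoCocycleClass]
  exact (P.isCoboundaryLift_cupCocycle_left hequiv hcompat a x₀ ha b).twoCocycleClass_eq_zero_iff hι hinj

end Left

/-! ### Right factor a coboundary in an ambient module -/

section Right

variable {SY : Type*} [CommSemiring SY] {Yt : Type*} [AddCommGroup Yt] [Module SY Yt]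
variable {πY : Representation SY Γ Yt} {ιY : Y →+ Yt} {Pt : X →+ Yt →+ B}

/-- ★ **Kato's formal argument, right factor.** If `b(τ) = τ ỹ - ỹ` in an ambient module `Ỹ ⊇ Y`
(`ιY` equivariant) and the pairing extends equivariantly to `⟨ , ⟩~ : X × Ỹ → B ⊇ ι(M)`, then
`g(σ) := -⟨a σ, σ ỹ⟩~` presents the cup-product cocycle:
`σ g(τ) - g(στ) + g(σ) = ι ⟨a σ, σ b τ⟩ = ι ((a ∪ b)(σ, τ))`.
[cite: Kato1993LNM1553, Ch. II, proof of Lemma 1.4.3] [cite: NeukirchSchmidtWingberg2008, I §3 (1.3.2), I §4] -/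
theorem isCoboundaryLift_cupCocycle_right
    (hequiv : ∀ (σ : Γ) (x : X) (y : Yt), π σ (Pt x y) = Pt (X.ρ σ x) (πY σ y))
    (hcompat : ∀ (x : X) (y : Y), Pt x (ιY y) = ι (P.toLin x y))
    (hιY : ∀ (σ : Γ) (y : Y), ιY (Y.ρ σ y) = πY σ (ιY y))
    (a : contOneCocycles X) (b : contOneCocycles Y) (y₀ : Yt) (hb : ∀ τ, ιY (b.1 τ) = πY τ y₀ - y₀) :
    IsCoboundaryLift π ι (fun σ => -Pt (a.1 σ) (πY σ y₀)) (P.cupCocycle a b) := fun σ τ => by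
  rw [cupCocycle_apply_eq_smul, ← hcompat, hιY, hb, map_sub, map_sub]
  simp only [map_neg, hequiv, a.2 σ τ, map_add, AddMonoidHom.add_apply, map_mul,
    Module.End.mul_apply]
  abel

variable [LocallyCompactSpace Γ]

/-- Hence `[a ∪ b]` is the class of any cocycle presented by `g(σ) = -⟨a σ, σ ỹ⟩~` (`ι` injective).
[cite: Kato1993LNM1553, Ch. II, proof of Lemma 1.4.3] -/
theorem cupClass_eq_twoCocycleClass_of_isCoboundaryLift_right (hinj : Injective ι)
    (hequiv : ∀ (σ : Γ) (x : X) (y : Yt), π σ (Pt x y) = Pt (X.ρ σ x) (πY σ y))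
    (hcompat : ∀ (x : X) (y : Y), Pt x (ιY y) = ι (P.toLin x y))
    (hιY : ∀ (σ : Γ) (y : Y), ιY (Y.ρ σ y) = πY σ (ιY y))
    (a : contOneCocycles X) (b : contOneCocycles Y) (y₀ : Yt) (hb : ∀ τ, ιY (b.1 τ) = πY τ y₀ - y₀)
    {c : contTwoCocycles ρ.toTopRep} (hc : IsCoboundaryLift π ι (fun σ => -Pt (a.1 σ) (πY σ y₀)) c) :
    P.cupClass a b = twoCocycleClass ρ.toTopRep c := by
  rw [cupClass_eq_twoCocycleClass,
    (P.isCoboundaryLift_cupCocycle_right hequiv hcompat hιY a b y₀ hb).unique hinj hc]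

/-- The cup product on classes as a connecting class, right factor: `[a] ∪ [b] = [c']` for every
presentation `c'` of `g' = (σ ↦ -⟨a σ, σ ỹ⟩~) + ι ∘ h + z`, `h` continuous, `z` a `1`-cocycle of `B`.
[cite: Kato1993LNM1553, Ch. II, proof of Lemma 1.4.3] [cite: NeukirchSchmidtWingberg2008, I §3 (1.3.2)] -/
theorem cupProduct_eq_twoCocycleClass_of_isCoboundaryLift_right
    (hι : ∀ (σ : Γ) (x : M), ι (ρ σ x) = π σ (ι x)) (hinj : Injective ι)
    (hequiv : ∀ (σ : Γ) (x : X) (y : Yt), π σ (Pt x y) = Pt (X.ρ σ x) (πY σ y))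
    (hcompat : ∀ (x : X) (y : Y), Pt x (ιY y) = ι (P.toLin x y))
    (hιY : ∀ (σ : Γ) (y : Y), ιY (Y.ρ σ y) = πY σ (ιY y))
    (a : contOneCocycles X) (b : contOneCocycles Y) (y₀ : Yt) (hb : ∀ τ, ιY (b.1 τ) = πY τ y₀ - y₀)
    {g' : Γ → B} {c' : contTwoCocycles ρ.toTopRep} (hc' : IsCoboundaryLift π ι g' c') (h : C(Γ, M))
    (z : Γ → B) (hz : ∀ σ τ, z (σ * τ) = z σ + π σ (z τ))
    (e : ∀ σ, g' σ = -Pt (a.1 σ) (πY σ y₀) + ι (h σ) + z σ) :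
    P.cupProduct (oneCocycleClass X a) (oneCocycleClass Y b) = twoCocycleClass ρ.toTopRep c' := by
  rw [cupProduct_oneCocycleClass_eq_twoCocycleClass]
  exact ((P.isCoboundaryLift_cupCocycle_right hequiv hcompat hιY a b y₀ hb).twoCocycleClass_eq hι hinj
    hc' h z hz e).symm

/-- Vanishing criterion, right factor: `[a ∪ b] = 0` iff `σ ↦ -⟨a σ, σ ỹ⟩~` is `ι ∘ h` plus a
`1`-cocycle of `B` for some continuous `h : Γ → M`. [cite: Kato1993LNM1553, Ch. II, proof of Lemma 1.4.3]
[cite: NeukirchSchmidtWingberg2008, I §3 (1.3.2)] -/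
theorem cupClass_eq_zero_iff_right (hι : ∀ (σ : Γ) (x : M), ι (ρ σ x) = π σ (ι x))
    (hinj : Injective ι)
    (hequiv : ∀ (σ : Γ) (x : X) (y : Yt), π σ (Pt x y) = Pt (X.ρ σ x) (πY σ y))
    (hcompat : ∀ (x : X) (y : Y), Pt x (ιY y) = ι (P.toLin x y))
    (hιY : ∀ (σ : Γ) (y : Y), ιY (Y.ρ σ y) = πY σ (ιY y))
    (a : contOneCocycles X) (b : contOneCocycles Y) (y₀ : Yt) (hb : ∀ τ, ιY (b.1 τ) = πY τ y₀ - y₀) :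
    P.cupClass a b = 0 ↔ ∃ h : C(Γ, M), ∀ σ τ,
      -Pt (a.1 (σ * τ)) (πY (σ * τ) y₀) - ι (h (σ * τ)) =
        (-Pt (a.1 σ) (πY σ y₀) - ι (h σ)) + π σ (-Pt (a.1 τ) (πY τ y₀) - ι (h τ)) := by
  rw [cupClass_eq_twoCocycleClass]
  exact (P.isCoboundaryLift_cupCocycle_right hequiv hcompat hιY a b y₀ hb).twoCocycleClass_eq_zero_iff
    hι hinj

end Right

end ContPairing

end Literature.NumberTheory.GaloisRepresentations

end
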